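import Literature.AnabelianGeometry.SemiGraphs.ArithLevelDataThm54
import Literature.AnabelianGeometry.SemiGraphs.ArithLevelDataCpt
import Literature.AnabelianGeometry.SemiGraphs.ArithEstrangementNoBranchPairAug
import HarnessLib

/-!
# [SemiAnbd] Theorem 5.4 (i), (ii) ASSEMBLED over arithmetic level data v2 (compact-subgroup dictionary
# in `Π_A`, (AI4″); exit (A54) of finding F-t6g3-1 ⇒ T54)

Mochizuki, *Semi-graphs of anabelioids*, Publ. RIMS **42** (2006), §5, Theorem 5.4 (i), (ii), manuscript
p. 66 (kurims `paper:url-f33ace170ff4`). [cite: MochizukiSemiAnbd2006, Thm 5.4, p. 66]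

PROOF-ONLY twin (T54 coordinator lineage abc-iut-w4-d085; sub-DAG `plan/L3/SUBDAG-SemiAnbd-Thm54.md`)
of abc-iut-w4-d053's assembly `ArithLevelDataThm54.lean` (never edited): the typed conclusions
`ArithMaximalCompactStatementI D aug` / `ArithMaximalCompactStatementII D aug` of abc-iut-L3-t3's
`ArithMaximalCompact.lean`, for decomposition data `D` over a semi-graph all of whose branches abut to a
vertex, FROM an arithmetic level datum **v2** `L : ArithLevelDataCpt 𝔾 D aug baseAct`
(`ArithLevelDataCpt.lean`: the package `ArithLevelData` with the branch-pair dictionary (AI4′) weakened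
to (AI4″) — for COMPACT fixing subgroups only, read in `Π_A` up to `Π_A`-conjugation, which is all print
moves and all the rows use), total arithmetic estrangement, `⊥` not arithmetically ample, and for (ii) in addition
Rmk 5.3.1's first sentence (`hR`) and "no verticial subgroup is edge-like" (`hVE`).  The mathematics is
in the rows, unchanged: clause 1 of (i) = abc-iut-w4-d029's `arith_conj1_of_hstar_ample`, (∗_j) = abc-iut-w4-d059's
v2 twin `hstar_of_isArithAmple_of_augDict` (ArithEstrangementNoBranchPairAug) of abc-iut-w4-d029's
`hstar_of_isArithAmple` — the ONLY place the dictionary enters, and it enters through the image in `Π_A`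
of a compact arithmetically ample `C` —, clause 2 and the assembly of (i) = abc-iut-w4-d059's
`arithMaximalCompactStatementI_of_levelData`, hEV = abc-iut-w4-d059's
`exists_verticial_inf_eq_of_isEdgeLike_of_levelData`, (ii) from (i) = abc-iut-w4-d085's
`arithMaximalCompactStatementII_of'`.  Every v1 datum `L : ArithLevelData …` feeds these through
`L.toCpt` (`ArithLevelDataCpt.lean`).  CONDITIONAL on the package `L`; typed ≠ proved beyond
it; nothing here bears on [IUTchIII] Cor 3.12.
-/

namespace Literature.AnabelianGeometry.SemiGraphs

open CategoryTheory Topology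

universe v₁ u₁ u₁' u₁''

namespace ArithLevelDataCpt

variable {Gtp : Type u₁} [Group Gtp] [TopologicalSpace Gtp] [IsTopologicalGroup Gtp]
  {PA : Type u₁'} [Group PA] [TopologicalSpace PA] [IsTopologicalGroup PA]
  {𝔾 : SemiGraph.{u₁}} {D : DecompositionData Gtp 𝔾.Vertex 𝔾.Branch} {aug : Gtp →* PA}
  {baseAct : PA →* Aut 𝔾}

/-- **[SemiAnbd] Thm 5.4 (i) ASSEMBLED over arithmetic level data v2**: for decomposition data `D` over a
semi-graph all of whose branches abut to a vertex, an arithmetic level datum `L : ArithLevelDataCpt …`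
(dictionary (AI4″) for compact subgroups, in `Π_A`), total arithmetic estrangement and `⊥` not
arithmetically ample, `ArithMaximalCompactStatementI D aug` holds — abc-iut-w4-d059's
`arithMaximalCompactStatementI_of_levelData` fed with abc-iut-w4-d029's clause 1
`arith_conj1_of_hstar_ample` and abc-iut-w4-d059's v2 (∗_j) `hstar_of_isArithAmple_of_augDict` (the
compactness of the arithmetically ample `C`, which the consumer supplies, is now USED).  Twin of
`ArithLevelData.arithMaximalCompactStatementI_of`; CONDITIONAL on the package `L`.
[cite: MochizukiSemiAnbd2006, Thm 5.4 (i), p. 66] -/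
theorem arithMaximalCompactStatementI_of (L : ArithLevelDataCpt.{v₁} 𝔾 D aug baseAct)
    (habuts : ∀ b : 𝔾.Branch, ∃ v : 𝔾.Vertex, D.abut b = some v)
    (hest : IsTotallyArithEstranged D aug) (hbot : ¬ IsArithAmple aug ⊥) :
    ArithMaximalCompactStatementI D aug := by
  -- every edge-like subgroup lies in a verticial one (p.65 `Π_{𝔊,b} ⊆ Π_{𝔊,v}`)
  have hEdgeVert : ∀ K : Subgroup Gtp, IsEdgeLike D K → ∃ W : Subgroup Gtp, IsVerticial D W ∧ K ≤ W := by
    rintro _ ⟨b, g, rfl⟩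
    obtain ⟨v, hv⟩ := habuts b
    exact ⟨conjSubgroup g (D.vertGp v), ⟨v, g, rfl⟩, Subgroup.map_mono (D.brGp_le_vertGp b v hv)⟩
  -- (∗_j) for every arithmetically ample COMPACT subgroup (row T54-3a, v2: compactness used, image form)
  have hstar : ∀ C : Subgroup Gtp, IsCompact (C : Set Gtp) → IsArithAmple aug C →
      ∀ j : L.J, ∃ (i : L.J) (h : j ≤ i), ∀ e e' : (L.tree i).Edge,
        (∀ γ : C, (L.act i γ).hom.edgeMap e = e) → (∀ γ : C, (L.act i γ).hom.edgeMap e' = e') →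
        (L.trans h).edgeMap e = (L.trans h).edgeMap e' := fun C hCc hCA j =>
    hstar_of_isArithAmple_of_augDict L.tree L.isTree L.act L.trans L.quot L.quot_isImmersion L.act_quot
      L.levelTrans_id L.levelTrans_comp L.levelTrans_act L.trans_quot L.stabBranchPairAug hest hbot C
      hCc hCA j
  refine arithMaximalCompactStatementI_of_levelData D aug L.tree L.act L.trans L.isTree
    L.trans_act_vertexMap L.noSwap L.fix L.edge ?_ hstar
  -- clause 1 (row T54-3b)
  exact arith_conj1_of_hstar_ample D L.tree L.act L.trans aug L.isTree L.vertex L.isOpen_ker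
    L.trans_comp L.trans_act L.noSwap (fun x hx => (L.stab x hx).imp fun W h => ⟨h.1, fun g hg => (h.2 g).mpr hg⟩)
    (fun j₁ ε hε => (L.edge j₁ ε hε).imp fun K h => ⟨h.1, fun g hg => (h.2 g).mpr hg⟩)
    hEdgeVert hstar

/-- **[SemiAnbd] Thm 5.4 (ii) ASSEMBLED over arithmetic level data v2**: given moreover Rmk 5.3.1's first
sentence (`hR`) and the rigidity "no verticial subgroup is edge-like" (`hVE`), "the arithmetically
maximal compact subgroups are precisely the verticial subgroups; the arithmetically ample intersections of
two distinct ones are precisely the edge-like subgroups" — abc-iut-w4-d085's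
`arithMaximalCompactStatementII_of'` over (i) from `arithMaximalCompactStatementI_of` and hEV from
abc-iut-w4-d059's `exists_verticial_inf_eq_of_isEdgeLike_of_levelData` (fields `stab`, `edgeFix`; the
dictionary (AI4″) is not used here).  Twin of `ArithLevelData.arithMaximalCompactStatementII_of`;
CONDITIONAL on the package `L` and the named inputs. [cite: MochizukiSemiAnbd2006, Thm 5.4 (ii), p. 66] -/
theorem arithMaximalCompactStatementII_of [T2Space Gtp] (L : ArithLevelDataCpt.{v₁} 𝔾 D aug baseAct)
    (habuts : ∀ b : 𝔾.Branch, ∃ v : 𝔾.Vertex, D.abut b = some v)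
    (hest : IsTotallyArithEstranged D aug) (hbot : ¬ IsArithAmple aug ⊥)
    (hR : VerticialEdgeLikeCompactAmpleStatement D aug)
    (hVE : ∀ K : Subgroup Gtp, IsVerticial D K → ¬ IsEdgeLike D K) :
    ArithMaximalCompactStatementII D aug :=
  arithMaximalCompactStatementII_of' (L.arithMaximalCompactStatementI_of habuts hest hbot) hR hVE
    (exists_verticial_inf_eq_of_isEdgeLike_of_levelData D L.tree L.act L.trans L.isTree
      L.trans_act_vertexMap L.noSwap L.stab L.edgeFix hVE)

end ArithLevelDataCpt

end Literature.AnabelianGeometry.SemiGraphs
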